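import Summits.CriticalPhenomena.SAWScalingLimit.Theorems.SAWDevelopingMapHexConjectureArchTailSummed
import Summits.CriticalPhenomena.SAWScalingLimit.Theorems.SAWDevelopingMapHexConjectureTriangleChart
import Summits.CriticalPhenomena.SAWScalingLimit.Theorems.SAWDevelopingMapHexConjectureTriangleArchTransfer
import HarnessLib

/-!
# Crux `HexConjecture` (stmt-CriticalPhenomena-0808), line `root-locality-replaces-loewner` (lead c8):
the FAR SIDE of the arch aspect bound is at most the Glazman–Manolescu / Krachun–Panagiotis triangle tail

Landing target:
`Summits/CriticalPhenomena/SAWScalingLimit/Theorems/SAWDevelopingMapHexConjectureFarSideTriangleTail.lean`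
(`--supports stmt-CriticalPhenomena-0808`; registered stub `stub_farArchMass_offsetSum_le_sub_triA`).

The lever of the line after seat c6 is the ARCH ASPECT BOUND (skeleton statement 2♮): the `x_c`-mass of the
critical half-plane arches `s_x → t_{x + d e₀}` of a finite `Λ` above the floor that reach distance `≥ R` from
`mid s_x`, summed over a window of offsets `d`, should be at most a constant times a reference-window two-point
mass.  This file makes the FAR SIDE explicit and absolute: for EVERY finite `Λ` in the rows `≥ x₁`, every finite
set `S` of non-zero offsets and `3L + 2 < R`,

  `Σ_{d ∈ S} Far^R_Λ(s_x → t_{x + d e₀}) ≤ 1/cos(3π/8) − A^Δ(L)`                    (`farArchMass_offsetSum_le_sub_triA`)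
  `1/cos(3π/8) − A^Δ(L) = (cos(π/8)/cos(3π/8)) · (D^Δ_l(L) + D^Δ_r(L)) = 2(1+√2)·triDl L`   (`inv_cos_sub_triA_eq`)

where `A^Δ(L) = HV.triA L` is the Glazman–Manolescu arch partition function of the lattice triangle `T_L` of side
`2L+1` based at the root and `triDl L = triDr L` its two far-side partition functions (`HexSAWTriangle.lean`,
identity `cos(3π/8) A^Δ + cos(π/8)(D^Δ_l + D^Δ_r) = 1`, Glazman–Manolescu Lemma 4.1 = Krachun–Panagiotis eq. (2)).
Mechanism (the template is the landed `farArchMass_offsetSum_le`, which proved the same with `ε` in place of the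
explicit tail): `Λ` lies in a half-strip `S_x(N)` (chart preimage of `V(S_{N+1,N+1})`); inside it the chart
preimage `T_x(L)` of `V(T_L)` consists of vertices within distance `3L + 2 < R` of `mid s_x`, so the walks of
`T_x(L)` are NEAR and disjoint from the far walks: far mass + `Z_{T_x(L)}` ≤ `Z_{S_x(N)}` offset by offset; summing
over the offset window, `Σ_d Z_{S_x(N)} ≤ 1/cos(3π/8)` (Duminil-Copin–Smirnov Lemma 2, `archTotal_le`) and
`Σ_d Z_{T_x(L)} ≥ A^Δ(L)` (every `α`-exit of `T_L` is a floor mid-edge at a non-zero offset `|d| ≤ L`,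
`stub_triA_le_sum_archMass_triChart`).  Consequence for the line: the arch aspect bound follows from a WINDOW
TWO-POINT LOWER BOUND `triDl ⌊R/4⌋ ≤ C · Σ_{d ∈ [θa R, θb R]} Z_{B_R}(s_x → t_d)` with no `Λ`, no inner window and
no far-mass functional (file `…AspectBoundOfWindowTwoPoint.lean`).
Sources: GlazmanManolescu2019 (Lemma 4.1), arXiv:2310.17299 (Krachun–Panagiotis, Lemma 2.2 / eq. (2)),
DuminilCopinSmirnov2012 (Lemma 2, §3).
-/

noncomputable section

open scoped BigOperators Topology Classical
open Filter Set
open Literature.Probability.LatticeModels (HexVertex hexGraph hexCenter Site)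
open Literature.Probability.RandomPlanarGeometry
open Literature.Probability.RandomPlanarGeometry.SAW
open Literature.Probability.RandomPlanarGeometry.SAW.HV
open Summit.CriticalPhenomena.SAWScalingLimit.Theorems.ObservableToSLE.FloorRatio

namespace Summit.CriticalPhenomena.SAWScalingLimit.Theorems.HexConjecture.RootLocality


/-! ### The triangle identity in the form used here -/

/-- **`1/cos(3π/8) − A^Δ(L) = (cos(π/8)/cos(3π/8))·(D^Δ_l(L) + D^Δ_r(L))`** — the Glazman–Manolescu triangle
identity `cos(3π/8) A^Δ + cos(π/8)(D^Δ_l + D^Δ_r) = 1` solved for the arch deficit.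
[cite: GlazmanManolescu2019, Lemma 4.1 (proof)] -/
theorem inv_cos_sub_triA_eq (L : ℕ) :
    (Real.cos (3 * Real.pi / 8))⁻¹ - triA L =
      Real.cos (Real.pi / 8) / Real.cos (3 * Real.pi / 8) * (triDl L + triDr L) := by
  have h := tri_identity L
  have hc : Real.cos (3 * Real.pi / 8) ≠ 0 := (cos_three_pi_div_eight_pos).ne'
  field_simp
  linarith

/-- The same with the two (equal) far sides merged: `1/cos(3π/8) − A^Δ(L) = 2(cos(π/8)/cos(3π/8))·triDl L`
(`cos(π/8)/cos(3π/8) = cot(π/8) = 1 + √2`). [cite: GlazmanManolescu2019, Lemma 4.1 (proof, "by vertical symmetry")] -/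
theorem inv_cos_sub_triA_eq_two_mul (L : ℕ) :
    (Real.cos (3 * Real.pi / 8))⁻¹ - triA L =
      2 * (Real.cos (Real.pi / 8) / Real.cos (3 * Real.pi / 8)) * triDl L := by
  rw [inv_cos_sub_triA_eq, ← triDl_eq_triDr]; ring

/-- The arch deficit is nonnegative: `A^Δ(L) ≤ 1/cos(3π/8)`. [cite: GlazmanManolescu2019, Lemma 4.1] -/
theorem triA_le_inv_cos (L : ℕ) : triA L ≤ (Real.cos (3 * Real.pi / 8))⁻¹ := by
  have h := inv_cos_sub_triA_eq L
  have : 0 ≤ Real.cos (Real.pi / 8) / Real.cos (3 * Real.pi / 8) * (triDl L + triDr L) :=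
    mul_nonneg (div_nonneg (cos_pi_div_eight_pos).le (cos_three_pi_div_eight_pos).le)
      (add_nonneg (triDl_nonneg L) (triDr_nonneg L))
  linarith

/-! ### The summed far mass inside a half-strip, against the inscribed triangle -/

/-- **Summed far mass ≤ arch total of the strip minus the triangle's arch mass.**  For `2L ≤ N` and a threshold
`R > 3L + 2`, the far masses of the arches `s_x → t_{x + d e₀}` inside `S_x(N)`, summed over the offset window of
`S_x(N)`, are at most `(Σ_d coded arch mass of S_{N+1,N+1}) − A^Δ(L)`: every walk of the inscribed triangle
`T_x(L) ⊆ S_x(N)` is near (`stub_triChartGeometry`, `archMass_le_nearArchMass`), far + near = total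
(`farArchMass_add_nearArchMass`), and the floor arch masses of `T_x(L)` sum to at least `A^Δ(L)`
(`stub_triA_le_sum_archMass_triChart`). [cite: GlazmanManolescu2019, §4.1; DuminilCopinSmirnov2012, Lemma 2 and §3] -/
theorem sum_farArchMass_halfStrip_le_sub_triA (x : Site 2) {L N : ℕ} (hN : 2 * L ≤ N) {R : ℝ}
    (hR : 3 * (L : ℝ) + 2 < R) :
    ∑ d ∈ (Finset.Icc (-((N : ℤ) + 1)) ((N : ℤ) + 1)).erase 0,
      (∑ γ : HexMidEdgeSAW ((stripV (N + 1) (N + 1)).map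
          (hvIso.trans (shift (-(x 0)) (-(x 1)))).symm.toEquiv.toEmbedding)
          s((x - Pi.single 1 1, 1), (x, 0))
          s((x + Pi.single 0 d - Pi.single 1 1, 1), (x + Pi.single 0 d, 0)),
        if ∃ v ∈ γ.verts, R ≤ dist (hexCenter v) (hexMidpoint s((x - Pi.single 1 1, 1), (x, 0)))
        then hexCriticalFugacity ^ γ.length else 0) ≤
      (∑ d ∈ (Finset.Icc (-((N : ℤ) + 1)) ((N : ℤ) + 1)).erase 0,
        ∑ P ∈ (midWalks (stripV (N + 1) (N + 1))).filter
            (fun P => finalDart P = ((d, 0, false), (d, -1, true)) ∨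
              finalDart P = ((d, -1, true), (d, 0, false))),
          hexCriticalFugacity ^ mwLen P) - triA L := by
  set s : Sym2 HexVertex := s((x - Pi.single 1 1, 1), (x, 0)) with hs
  set HSN := (stripV (N + 1) (N + 1)).map
    (hvIso.trans (shift (-(x 0)) (-(x 1)))).symm.toEquiv.toEmbedding with hHSN
  set HT := (triV L).map
    (hvIso.trans (shift (-(x 0)) (-(x 1)))).symm.toEquiv.toEmbedding with hHT
  set DN := (Finset.Icc (-((N : ℤ) + 1)) ((N : ℤ) + 1)).erase 0 with hDN
  set DL := (Finset.Icc (-(L : ℤ)) (L : ℤ)).erase 0 with hDL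
  have hsub : HT ⊆ HSN := triChart_subset_halfStrip x hN
  have hnear : ∀ w ∈ HT, dist (hexCenter w) (hexMidpoint s) < R := fun w hw =>
    lt_of_le_of_lt (triChart_geometry hw).2 hR
  -- termwise: far + (mass of the triangle) ≤ total
  have hterm : ∀ d ∈ DN,
      (∑ γ : HexMidEdgeSAW HSN s
          s((x + Pi.single 0 d - Pi.single 1 1, 1), (x + Pi.single 0 d, 0)),
        if ∃ v ∈ γ.verts, R ≤ dist (hexCenter v) (hexMidpoint s)
        then hexCriticalFugacity ^ γ.length else 0) +
      (∑ γ : HexMidEdgeSAW HT s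
          s((x + Pi.single 0 d - Pi.single 1 1, 1), (x + Pi.single 0 d, 0)),
        hexCriticalFugacity ^ γ.length) ≤
      ∑ P ∈ (midWalks (stripV (N + 1) (N + 1))).filter
          (fun P => finalDart P = ((d, 0, false), (d, -1, true)) ∨
            finalDart P = ((d, -1, true), (d, 0, false))),
        hexCriticalFugacity ^ mwLen P := by
    intro d hd
    rw [← archMass_halfStrip_offset x N d (mem_offsetWindow_iff.1 hd).2,
      ← farArchMass_add_nearArchMass HSN s _ R]
    exact add_le_add le_rfl (archMass_le_nearArchMass hsub s _ R hnear)
  have hsum := Finset.sum_le_sum hterm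
  rw [Finset.sum_add_distrib] at hsum
  -- the triangle's floor arch masses over the larger window dominate `A^Δ(L)`
  have hDLN : DL ⊆ DN := by
    intro d hd
    rw [hDL, Finset.mem_erase, Finset.mem_Icc] at hd
    rw [hDN, Finset.mem_erase, Finset.mem_Icc]
    exact ⟨hd.1, by omega, by omega⟩
  have hA : triA L ≤ ∑ d ∈ DN, ∑ γ : HexMidEdgeSAW HT s
      s((x + Pi.single 0 d - Pi.single 1 1, 1), (x + Pi.single 0 d, 0)),
      hexCriticalFugacity ^ γ.length :=
    (stub_triA_le_sum_archMass_triChart x L).trans (Finset.sum_le_sum_of_subset_of_nonneg hDLN fun d _ _ => archMass_nonneg _ _ _)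
  linarith

/-! ### The theorem -/

/-- **THE FAR SIDE OF THE ARCH ASPECT BOUND ≤ THE TRIANGLE TAIL.**  For every cell `x`, every finite vertex set
`Λ` in the rows `≥ x₁`, every finite set `S` of non-zero offsets, every `L` and every threshold `R > 3L + 2`,
the `x_c`-masses of the self-avoiding walks `s_x → t_{x + d e₀}` in `Λ` having a vertex at distance `≥ R` from
`mid s_x`, summed over `d ∈ S`, total at most `1/cos(3π/8) − A^Δ(L)` (`= 2(1+√2)·triDl L`, `inv_cos_sub_triA_eq_two_mul`):
the arches leaving the half-disc of radius `R` leave the inscribed lattice triangle `T_L`, and by the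
Glazman–Manolescu identity the arches of the half-plane not contained in `T_L` weigh at most the triangle tail.
[cite: GlazmanManolescu2019, Lemma 4.1; DuminilCopinSmirnov2012, Lemma 2 and §3 ("A_{T,L} ≤ 1/c_α")] -/
theorem farArchMass_offsetSum_le_sub_triA (x : Site 2) (Λ : Finset HexVertex) (hΛ : ∀ v ∈ Λ, x 1 ≤ v.1 1)
    (S : Finset ℤ) (hS : 0 ∉ S) (L : ℕ) (R : ℝ) (hR : 3 * (L : ℝ) + 2 < R) :
    ∑ d ∈ S, (∑ γ : HexMidEdgeSAW Λ s((x - Pi.single 1 1, 1), (x, 0))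
        s((x + Pi.single 0 d - Pi.single 1 1, 1), (x + Pi.single 0 d, 0)),
      if ∃ v ∈ γ.verts, R ≤ dist (hexCenter v) (hexMidpoint s((x - Pi.single 1 1, 1), (x, 0)))
      then hexCriticalFugacity ^ γ.length else 0) ≤
      (Real.cos (3 * Real.pi / 8))⁻¹ - triA L := by
  -- a half-strip containing `Λ` and the triangle, whose offset window contains `S`
  set N₀ : ℕ := 2 * L + ∑ d ∈ S, (|d|).toNat with hN₀
  obtain ⟨N, hN₀N, hΛN⟩ := exists_subset_halfStrip Λ x hΛ N₀
  have hLN : 2 * L ≤ N := le_trans (Nat.le_add_right _ _) hN₀N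
  set HSN := (stripV (N + 1) (N + 1)).map
    (hvIso.trans (shift (-(x 0)) (-(x 1)))).symm.toEquiv.toEmbedding with hHSN
  set DN := (Finset.Icc (-((N : ℤ) + 1)) ((N : ℤ) + 1)).erase 0 with hDN
  have hSD : S ⊆ DN := by
    intro d hd
    rw [hDN, mem_offsetWindow_iff]
    refine ⟨fun h => hS (h ▸ hd), ?_⟩
    have h1 : (|d|).toNat ≤ ∑ d' ∈ S, (|d'|).toNat :=
      Finset.single_le_sum (f := fun d' : ℤ => (|d'|).toNat) (fun _ _ => Nat.zero_le _) hd
    have h2 : (|d| : ℤ) = ((|d|).toNat : ℤ) := (Int.toNat_of_nonneg (abs_nonneg d)).symm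
    have h3 : ((|d|).toNat : ℤ) ≤ N := by exact_mod_cast h1.trans ((Nat.le_add_left _ _).trans hN₀N)
    omega
  set s : Sym2 HexVertex := s((x - Pi.single 1 1, 1), (x, 0)) with hs
  calc ∑ d ∈ S, (∑ γ : HexMidEdgeSAW Λ s
          s((x + Pi.single 0 d - Pi.single 1 1, 1), (x + Pi.single 0 d, 0)),
          if ∃ v ∈ γ.verts, R ≤ dist (hexCenter v) (hexMidpoint s)
          then hexCriticalFugacity ^ γ.length else 0)
      ≤ ∑ d ∈ S, (∑ γ : HexMidEdgeSAW HSN s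
          s((x + Pi.single 0 d - Pi.single 1 1, 1), (x + Pi.single 0 d, 0)),
          if ∃ v ∈ γ.verts, R ≤ dist (hexCenter v) (hexMidpoint s)
          then hexCriticalFugacity ^ γ.length else 0) :=
        Finset.sum_le_sum fun d _ => farArchMass_mono hΛN s _ R
    _ ≤ ∑ d ∈ DN, (∑ γ : HexMidEdgeSAW HSN s
          s((x + Pi.single 0 d - Pi.single 1 1, 1), (x + Pi.single 0 d, 0)),
          if ∃ v ∈ γ.verts, R ≤ dist (hexCenter v) (hexMidpoint s)
          then hexCriticalFugacity ^ γ.length else 0) := by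
        refine Finset.sum_le_sum_of_subset_of_nonneg hSD fun d _ _ => ?_
        refine Finset.sum_nonneg fun γ _ => ?_
        split_ifs
        · exact pow_nonneg hexCriticalFugacity_pos_lt_one.1.le _
        · exact le_rfl
    _ ≤ _ := sum_farArchMass_halfStrip_le_sub_triA x hLN hR
    _ ≤ (Real.cos (3 * Real.pi / 8))⁻¹ - triA L := by linarith [archTotal_le N]

/-- **Registered stub `stub_farArchMass_offsetSum_le_sub_triA`** (crux item stmt-CriticalPhenomena-0808, line
`root-locality-replaces-loewner`, lead c8): the far side of the arch aspect bound is at most the triangle tail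
`1/cos(3π/8) − A^Δ(L)`, uniformly in the domain above the floor, the root cell and the offset set
(`farArchMass_offsetSum_le_sub_triA`). [cite: GlazmanManolescu2019, Lemma 4.1; DuminilCopinSmirnov2012, Lemma 2 and §3] -/
theorem stub_farArchMass_offsetSum_le_sub_triA : ∀ (x : Literature.Probability.LatticeModels.Site 2)
    (Λ : Finset Literature.Probability.LatticeModels.HexVertex), (∀ v ∈ Λ, x 1 ≤ v.1 1) →
    ∀ (S : Finset ℤ), 0 ∉ S → ∀ (L : ℕ) (R : ℝ), 3 * (L : ℝ) + 2 < R →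
    ∑ d ∈ S, (∑ γ : Literature.Probability.RandomPlanarGeometry.SAW.HexMidEdgeSAW Λ
        s((x - Pi.single 1 1, 1), (x, 0))
        s((x + Pi.single 0 d - Pi.single 1 1, 1), (x + Pi.single 0 d, 0)),
      if ∃ v ∈ γ.verts, R ≤ dist (Literature.Probability.LatticeModels.hexCenter v)
          (Literature.Probability.RandomPlanarGeometry.SAW.hexMidpoint s((x - Pi.single 1 1, 1), (x, 0)))
      then Literature.Probability.RandomPlanarGeometry.SAW.hexCriticalFugacity ^ γ.length else 0) ≤
      (Real.cos (3 * Real.pi / 8))⁻¹ - Literature.Probability.RandomPlanarGeometry.SAW.HV.triA L :=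
  fun x Λ hΛ S hS L R hR => farArchMass_offsetSum_le_sub_triA x Λ hΛ S hS L R hR

end Summit.CriticalPhenomena.SAWScalingLimit.Theorems.HexConjecture.RootLocality

end
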